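import Summits.AtomisticToContinuum.BoseEinsteinCondensation.Theses.BECHeatBathGap

/-!
# Route `BECHeatBathGap` — support item `NearMinimiserStability` (stmt-AtomisticToContinuum-14371)

Closes stmt-AtomisticToContinuum-14371: the exact route declaration
`Summit.AtomisticToContinuum.BoseEinsteinCondensation.Theses.BECHeatBathGap.NearMinimiserStability`,

  `GroundStateRigidity → ∀ v repulsive finite-range, ∃ ρ₀ > 0, ∀ ρ ∈ (0, ρ₀), ∀ᶠ N, ∀ m,`
  `(∀ δ > 0, ∃ δ-near-minimiser Ψ with m ≤ λ_max(Ψ)) → ∃ δ > 0, ∀ δ-near-minimiser Ψ, m/2 ≤ λ_max(Ψ)`,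

where `λ_max = maxOccupation N` is the largest eigenvalue of the one-particle density matrix
[LSSY2005, §1.2] and near-minimisers are Dirichlet trial states in the box of side `(N/ρ)^{1/3}`.

Proof (glue, as filed by the planner and grounded g25-44): fix `v`, take `ρ₀` from
`GroundStateRigidity`; eventually in `N = n + 1`, given `m` (w.l.o.g. `0 < m`), choose a scale
`η > 0` with `16 N η ≤ m` (`η = 1` if `m = ⊤`) and the rigidity slack `δ = δ(η)`. For a
`δ`-near-minimiser `Ψ` pick (hypothesis) a `δ`-near-minimiser `Φ` with `m ≤ λ_max(Φ)`; rigidity gives a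
unit `c` with `‖Φ − cΨ‖₂² ≤ η`, and the landed `OccupationStability_holds` (`occ^{1/2}` is
`√N`-Lipschitz up to phase, sup over normalised modes) gives `√m ≤ √λ_max(Ψ) + √(Nη) ≤ √λ_max(Ψ) + √m/4`,
hence `3√m ≤ 4√λ_max(Ψ)`, `9m ≤ 16 λ_max(Ψ) ≤ 18 λ_max(Ψ)`, i.e. `m/2 ≤ λ_max(Ψ)` (the corner
`λ_max(Ψ) = ⊤` is trivial and `m = ⊤` is then contradictory). This is the same argument that the
route's deciding theorem `closes` carries inline (Theses rev 5).
-/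

noncomputable section

namespace Summit.AtomisticToContinuum.BoseEinsteinCondensation.Theorems

open MeasureTheory Filter
open scoped ENNReal NNReal
open Literature.MathematicalPhysics.QuantumManyBody.BoseGas
open Summit.AtomisticToContinuum.BoseEinsteinCondensation.Theses.BECHeatBathGap

/-- **`NearMinimiserStability` (route `BECHeatBathGap`, item stmt-AtomisticToContinuum-14371), proved.**
Under `GroundStateRigidity`: for every repulsive finite-range `v`, small `ρ` and all large `N`, if at
every slack `δ > 0` SOME `δ`-near-minimiser has `maxOccupation ≥ m`, then at some slack `δ > 0` EVERY
`δ`-near-minimiser has `maxOccupation ≥ m / 2`. Rigidity at a scale `η` with `16 N η ≤ m` plus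
`OccupationStability_holds` (`occ^{1/2}` is `√N`-Lipschitz in `L²` up to phase) give
`3 √m ≤ 4 √λ_max`, whence `m / 2 ≤ λ_max`. [cite: LiebSeiringerSolovejYngvason2005, §1.2 (1.17)
(conventions only; the statement is route glue)] -/
theorem becHeatBathGap_nearMinimiserStability_proof : NearMinimiserStability := by
  intro hR v hv
  obtain ⟨ρ₀, hρ₀, H⟩ := hR v hv
  refine ⟨ρ₀, hρ₀, fun ρ hρ hρlt => ?_⟩
  filter_upwards [H ρ hρ hρlt, Filter.eventually_ge_atTop 1] with N hN hN1
  intro m hm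
  obtain ⟨n, rfl⟩ : ∃ n, N = n + 1 := ⟨N - 1, by omega⟩
  rcases eq_or_ne m 0 with rfl | hm0
  · exact ⟨1, one_pos, fun Ψ _ => by simp⟩
  have hsq : ∀ x : ℝ≥0∞, (x ^ (1 / 2 : ℝ)) ^ 2 = x := fun x => by
    rw [← ENNReal.rpow_two, ← ENNReal.rpow_mul]; norm_num
  have hsq' : ∀ x : ℝ≥0∞, (x ^ 2) ^ (1 / 2 : ℝ) = x := fun x => by
    rw [← ENNReal.rpow_two, ← ENNReal.rpow_mul]; norm_num
  -- a scale `η > 0` with `16 (n+1) η ≤ m`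
  obtain ⟨η, hη, hηm⟩ : ∃ η : ℝ, 0 < η ∧ 16 * (((n + 1 : ℕ) : ℝ≥0∞) * ENNReal.ofReal η) ≤ m := by
    rcases eq_or_ne m ⊤ with hmtop | hmtop
    · exact ⟨1, one_pos, by rw [hmtop]; exact le_top⟩
    have hmpos : 0 < m.toReal := ENNReal.toReal_pos hm0 hmtop
    refine ⟨m.toReal / (16 * (n + 1)), by positivity, le_of_eq ?_⟩
    rw [← ENNReal.ofReal_natCast, ← ENNReal.ofReal_mul (by positivity), ← ENNReal.ofReal_ofNat 16,
      ← ENNReal.ofReal_mul (by norm_num), ← ENNReal.ofReal_toReal hmtop]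
    congr 1
    rw [ENNReal.toReal_ofReal hmpos.le]
    push_cast
    field_simp
  obtain ⟨δ, hδ, hrig⟩ := hN η hη
  refine ⟨δ, hδ, fun Ψ hΨ => ?_⟩
  obtain ⟨Φ, hΦ, hmΦ⟩ := hm δ hδ
  obtain ⟨c, hc, hdist⟩ := hrig Φ Ψ hΦ hΨ
  set s := maxOccupation (n + 1) Ψ.ψ
  set t : ℝ≥0∞ := (((n + 1 : ℕ) : ℝ≥0∞) * ENNReal.ofReal η) ^ (1 / 2 : ℝ) with ht
  -- every mode occupation of the witness `Φ` is `≤ (√s + t)²`, hence so is `m`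
  have hmle : m ≤ (s ^ (1 / 2 : ℝ) + t) ^ 2 := hmΦ.trans (iSup₂_le fun u hu => by
    have h1 := OccupationStability_holds n _ u hu.1 hu.2 Φ Ψ c hc
    have h2 := ENNReal.rpow_le_rpow (z := (1 / 2 : ℝ))
      (occupation_le_maxOccupation Ψ.ψ hu.1 hu.2) (by norm_num)
    have h3 : ((n + 1 : ℕ) : ℝ≥0∞) ^ (1 / 2 : ℝ) *
        (∫⁻ X, (‖Φ.ψ X - c * Ψ.ψ X‖₊ : ℝ≥0∞) ^ 2) ^ (1 / 2 : ℝ) ≤ t := by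
      rw [ht, ENNReal.mul_rpow_of_nonneg _ _ (by norm_num : (0:ℝ) ≤ 1 / 2)]
      gcongr
    rw [← hsq (occupation (n + 1) u Φ.ψ)]
    gcongr
    exact h1.trans (add_le_add h2 h3))
  have ht_top : t ≠ ⊤ := ENNReal.rpow_ne_top_of_nonneg (by norm_num)
    (ENNReal.mul_ne_top (ENNReal.natCast_ne_top _) ENNReal.ofReal_ne_top)
  -- `4 t ≤ √m ≤ √s + t`
  have h4t : 4 * t ≤ m ^ (1 / 2 : ℝ) := by
    have h16 : (16 * (((n + 1 : ℕ) : ℝ≥0∞) * ENNReal.ofReal η)) ^ (1 / 2 : ℝ) = 4 * t := by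
      rw [ht, ENNReal.mul_rpow_of_nonneg 16 _ (by norm_num : (0:ℝ) ≤ 1 / 2)]
      congr 1
      rw [show (16 : ℝ≥0∞) = 4 ^ 2 by norm_num, hsq']
    rw [← h16]
    exact ENNReal.rpow_le_rpow hηm (by norm_num)
  have hroot : m ^ (1 / 2 : ℝ) ≤ s ^ (1 / 2 : ℝ) + t := by
    rw [← hsq' (s ^ (1 / 2 : ℝ) + t)]
    exact ENNReal.rpow_le_rpow hmle (by norm_num)
  rcases eq_or_ne s ⊤ with hstop | hstop
  · rw [hstop]; exact le_top
  have hs2 : s ^ (1 / 2 : ℝ) ≠ ⊤ := ENNReal.rpow_ne_top_of_nonneg (by norm_num) hstop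
  rcases eq_or_ne m ⊤ with hmtop | hmtop
  · exfalso
    rw [hmtop, ENNReal.top_rpow_of_pos (by norm_num : (0:ℝ) < 1 / 2)] at hroot
    exact (ENNReal.add_ne_top.2 ⟨hs2, ht_top⟩) (top_le_iff.1 hroot)
  have hm2 : m ^ (1 / 2 : ℝ) ≠ ⊤ := ENNReal.rpow_ne_top_of_nonneg (by norm_num) hmtop
  -- `3 √m ≤ 4 √s`, squared: `9 m ≤ 16 s ≤ 9 (2 s)`
  have h34 : 3 * m ^ (1 / 2 : ℝ) ≤ 4 * s ^ (1 / 2 : ℝ) := by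
    refine (ENNReal.add_le_add_iff_right hm2).1 ?_
    calc 3 * m ^ (1 / 2 : ℝ) + m ^ (1 / 2 : ℝ) = 4 * m ^ (1 / 2 : ℝ) := by ring
      _ ≤ 4 * (s ^ (1 / 2 : ℝ) + t) := by gcongr
      _ = 4 * s ^ (1 / 2 : ℝ) + 4 * t := by ring
      _ ≤ 4 * s ^ (1 / 2 : ℝ) + m ^ (1 / 2 : ℝ) := by gcongr
  have h916 : 9 * m ≤ 9 * (2 * s) := by
    have h := pow_le_pow_left' h34 2
    rw [mul_pow, mul_pow, hsq, hsq] at h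
    norm_num at h
    exact h.trans (by rw [← mul_assoc]; gcongr; norm_num)
  exact ENNReal.div_le_of_le_mul (by
    rw [mul_comm]; exact (ENNReal.mul_le_mul_iff_right (by norm_num) (by norm_num)).1 h916)

end Summit.AtomisticToContinuum.BoseEinsteinCondensation.Theorems

end
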